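import Summits.HubbardSuperconductivity.HubbardSuperconductivity.Theorems.AnisotropyChordTransferOneBodyDuality

/-!
# Route `AnisotropyChord` / H0 rotor rung, route (1): `FerroSectorGapCLR` IS SHARP — the Temple-form sector gap of `H(1)` is
# `≤ 1 − cos(2π/L)` in every non-trivial sector

**`sectorGapAtLeast_one_le`** — for `L ≥ 3`, every sector `M` with `0 < |V|/2 + M < |V|` carrying a Perron amplitude, and every `g`:
`SectorGapAtLeast L 1 M g → g ≤ 1 − cos(2π/L)`.  Test amplitude: the normalised sector-restricted cosine density wave, an exact
eigenvector of `A = fmOp` with eigenvalue `1 − cos(2π/L)` (`fmOp_cosWave_one`, `…TransferOneBodyDuality`), orthogonal to the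
Perron amplitude (which is uniform on the sector at `Δ = 1`, `perron_const_of_one`); it is non-zero because otherwise the cosine
wave would be constant on the sites.  With `ferroSectorGapCLR_holds` (`…TransferExclusionGap`) the Temple-form sector gap of `H(1)`
EQUALS the one-magnon gap in every non-trivial sector.

Prover seat `hubbard-h0-rotor-p1` g20; helper for the S-bridge dossier of stmt-HubbardSuperconductivity-19089.  No definition is
introduced; nothing here is a statement about the Hubbard model.
-/

set_option linter.dupNamespace false
set_option autoImplicit false

noncomputable section

open Finset Complex
open scoped ComplexConjugate
open Literature.MathematicalPhysics.QuantumLattice Literature.Probability.LatticeModels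
open Summit.HubbardSuperconductivity.HubbardSuperconductivity.Theorems.AnisotropyChord.InsertionEntropy
open Summit.HubbardSuperconductivity.HubbardSuperconductivity.Theorems.AnisotropyChord.Tower

namespace Summit.HubbardSuperconductivity.HubbardSuperconductivity.Theorems.AnisotropyChord.Transfer

variable {L : ℕ} [NeZero L]

/-! ## Sharpness of `FerroSectorGapCLR` -/

/-- **The Temple-form sector gap of `H(1)` is at most the one-magnon gap** in every sector `M` with `0 < |V|/2 + M < |V|`
particles that carries a Perron amplitude (`L ≥ 3`): `SectorGapAtLeast L 1 M g → g ≤ 1 − cos(2π/L)`.  Test amplitude: the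
normalised sector-restricted cosine density wave, an exact eigenvector of `A` (`fmOp_cosWave_one`) orthogonal to the (uniform)
Perron amplitude. [folklore] -/
theorem sectorGapAtLeast_one_le (hL : 3 ≤ L) {M g : ℝ} {a : TensorIndex (TorusSite 2 L) 2 → ℝ}
    (ha : IsPerronSectorGroundAmplitude L 1 M a)
    (hn0 : 0 < (Fintype.card (TorusSite 2 L) : ℝ) / 2 + M)
    (hnV : (Fintype.card (TorusSite 2 L) : ℝ) / 2 + M < (Fintype.card (TorusSite 2 L) : ℝ))
    (hg : SectorGapAtLeast L 1 M g) :
    g ≤ 1 - Real.cos (2 * Real.pi / L) := by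
  classical
  have hL2 : 2 ≤ L := by omega
  haveI : Fact (1 < L) := ⟨by omega⟩
  set n : ℝ := (Fintype.card (TorusSite 2 L) : ℝ) / 2 + M with hn
  set lam : ℝ := 1 - Real.cos (2 * Real.pi / L) with hlam
  set k : TorusSite 2 L := Pi.single 0 1 with hk
  set f : TorusSite 2 L → ℝ := fun z => (torusChar k z).re with hf
  -- the test amplitude
  set b : TensorIndex (TorusSite 2 L) 2 → ℝ :=
    fun τ => (if zerosCard τ = n then (1:ℝ) else 0) * ∑ z, (1 - ((τ z : ℕ) : ℝ)) * f z with hb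
  have hbsupp : ∀ σ, b σ ≠ 0 → zerosCard σ = n := by
    intro σ h
    by_contra hne
    exact h (by simp only [hb, hne, if_false, zero_mul])
  have hbA : ∀ σ, fmOp (torusGraph 2 L) b σ = lam * b σ := fun σ => fmOp_cosWave_one hL n σ
  -- Perron data at `Δ = 1`
  have hasupp : ∀ σ, a σ ≠ 0 → zerosCard σ = n := perron_support ha
  obtain ⟨-, hE⟩ := perron_inner_fmOp_eq_zero_of_one ha
  have hconst := perron_const_of_one ha
  obtain ⟨σ₀, hσ₀⟩ : ∃ σ, a σ ≠ 0 := by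
    by_contra h
    push Not at h
    have hu := ha.unit
    simp [h] at hu
  have hσ₀n : zerosCard σ₀ = n := hasupp σ₀ hσ₀
  -- values of a `Fin 2` coordinate read in `ℝ`
  have hval : ∀ (σ : TensorIndex (TorusSite 2 L) 2) (z : TorusSite 2 L),
      ((σ z : ℕ) : ℝ) = 0 ∨ ((σ z : ℕ) : ℝ) = 1 := by
    intro σ z
    rcases Fin.exists_fin_two.mp ⟨σ z, rfl⟩ with h | h
    · left; simp [h]
    · right; simp [h]
  -- (1) the Perron amplitude is orthogonal to `b`
  -- the sector count `Σ_{σ ∈ S} n_x(σ)` does not depend on `x`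
  have hcount : ∀ x y : TorusSite 2 L,
      (∑ σ : TensorIndex (TorusSite 2 L) 2, (if zerosCard σ = n then (1:ℝ) else 0) * (1 - ((σ x : ℕ) : ℝ)))
        = ∑ σ : TensorIndex (TorusSite 2 L) 2, (if zerosCard σ = n then (1:ℝ) else 0) * (1 - ((σ y : ℕ) : ℝ)) := by
    intro x y
    rw [← Equiv.sum_comp (Equiv.arrowCongr (Equiv.swap x y) (Equiv.refl (Fin 2)))
      (fun σ => (if zerosCard σ = n then (1:ℝ) else 0) * (1 - ((σ y : ℕ) : ℝ)))]
    refine Finset.sum_congr rfl fun σ _ => ?_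
    have h1 : (Equiv.arrowCongr (Equiv.swap x y) (Equiv.refl (Fin 2))) σ = σ ∘ ⇑(Equiv.swap x y) := by
      funext z
      simp [Equiv.arrowCongr_apply, Equiv.symm_swap]
    rw [h1, zerosCard_comp_perm]
    simp only [Function.comp_apply, Equiv.swap_apply_right]
  have hsumf : ∑ x : TorusSite 2 L, f x = 0 := by
    have h := sum_torusChar_right (d := 2) (L := L) k
    rw [if_neg (torus_single_ne_zero hL2 0)] at h
    have := congrArg Complex.re h
    rw [Complex.re_sum] at this
    simpa [hf] using this
  have hsumb : ∑ σ, b σ = 0 := by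
    calc ∑ σ, b σ = ∑ σ, ∑ x, (if zerosCard σ = n then (1:ℝ) else 0) * (1 - ((σ x : ℕ) : ℝ)) * f x := by
          refine Finset.sum_congr rfl fun σ _ => ?_
          simp only [hb, Finset.mul_sum]
          exact Finset.sum_congr rfl fun x _ => by ring
      _ = ∑ x, f x * ∑ σ : TensorIndex (TorusSite 2 L) 2,
            (if zerosCard σ = n then (1:ℝ) else 0) * (1 - ((σ x : ℕ) : ℝ)) := by
          rw [Finset.sum_comm]
          refine Finset.sum_congr rfl fun x _ => ?_
          rw [Finset.mul_sum]
          exact Finset.sum_congr rfl fun σ _ => by ring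
      _ = (∑ x, f x) * ∑ σ : TensorIndex (TorusSite 2 L) 2,
            (if zerosCard σ = n then (1:ℝ) else 0) * (1 - ((σ (0 : TorusSite 2 L) : ℕ) : ℝ)) := by
          rw [Finset.sum_mul]
          exact Finset.sum_congr rfl fun x _ => by rw [hcount x 0]
      _ = 0 := by rw [hsumf, zero_mul]
  have hab0 : ∑ σ, a σ * b σ = 0 := by
    have hab : ∀ σ, a σ * b σ = a σ₀ * b σ := by
      intro σ
      by_cases hσ : zerosCard σ = n
      · rw [hconst σ σ₀ (hσ.trans hσ₀n.symm)]
      · have h1 : b σ = 0 := by by_contra h'; exact hσ (hbsupp σ h')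
        rw [h1, mul_zero, mul_zero]
    simp_rw [hab]
    rw [← Finset.mul_sum, hsumb, mul_zero]
  -- (2) `b ≠ 0`: otherwise `f` would be constant on the sites
  have hfdiff : ∀ (x y : TorusSite 2 L) (σ : TensorIndex (TorusSite 2 L) 2), zerosCard σ = n → σ x = 0 → σ y = 1 →
      b σ - b (σ ∘ ⇑(Equiv.swap x y)) = f x - f y := by
    intro x y σ hσ hx hy
    simp only [hb, zerosCard_comp_perm, hσ, if_true, one_mul]
    rw [oneBody_sub_swap]
    simp [hx, hy]
  have hbne : ∑ σ, b σ ^ 2 ≠ 0 := by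
    intro hzero
    have hb0 : ∀ σ, b σ = 0 := fun σ => by
      have := (Finset.sum_eq_zero_iff_of_nonneg (fun σ _ => sq_nonneg (b σ))).mp hzero σ (Finset.mem_univ σ)
      exact pow_eq_zero_iff two_ne_zero |>.mp this
    have hcardn : ((Finset.univ.filter fun z => σ₀ z = 0).card : ℝ) = n := hσ₀n
    -- `f` takes the same value at any two distinct sites
    have hfconst : ∀ x y : TorusSite 2 L, x ≠ y → f x = f y := by
      intro x y hxy
      -- a configuration of the sector with a particle at `x`
      obtain ⟨σ₁, hσ₁n, hσ₁x⟩ : ∃ σ₁ : TensorIndex (TorusSite 2 L) 2, zerosCard σ₁ = n ∧ σ₁ x = 0 := by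
        by_cases hx : σ₀ x = 0
        · exact ⟨σ₀, hσ₀n, hx⟩
        · obtain ⟨z, hz⟩ : ∃ z, σ₀ z = 0 := by
            by_contra h
            push Not at h
            have : (Finset.univ.filter fun z => σ₀ z = 0) = ∅ :=
              Finset.filter_eq_empty_iff.mpr fun z _ => h z
            rw [this, Finset.card_empty, Nat.cast_zero] at hcardn
            linarith
          refine ⟨σ₀ ∘ ⇑(Equiv.swap x z), by rw [zerosCard_comp_perm, hσ₀n], ?_⟩
          simp [Function.comp_apply, Equiv.swap_apply_left, hz]
      -- … and a hole at `y`
      obtain ⟨σ₂, hσ₂n, hσ₂x, hσ₂y⟩ : ∃ σ₂ : TensorIndex (TorusSite 2 L) 2,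
          zerosCard σ₂ = n ∧ σ₂ x = 0 ∧ σ₂ y = 1 := by
        by_cases hy : σ₁ y = 0
        · -- find a hole `w` (there are `|V| − n > 0` of them) and move it to `y`
          obtain ⟨w, hw⟩ : ∃ w, σ₁ w ≠ 0 := by
            by_contra h
            push Not at h
            have hall : (Finset.univ.filter fun z => σ₁ z = 0) = Finset.univ :=
              Finset.filter_true_of_mem fun z _ => h z
            have hc : zerosCard σ₁ = (Fintype.card (TorusSite 2 L) : ℝ) := by
              unfold zerosCard; rw [hall, Finset.card_univ]
            rw [hσ₁n] at hc
            linarith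
          have hw1 : σ₁ w = 1 := by
            rcases Fin.exists_fin_two.mp ⟨σ₁ w, rfl⟩ with h | h
            · exact absurd h hw
            · exact h
          have hwx : w ≠ x := by rintro rfl; exact hw hσ₁x
          have hwy : w ≠ y := by rintro rfl; exact hw hy
          refine ⟨σ₁ ∘ ⇑(Equiv.swap y w), by rw [zerosCard_comp_perm, hσ₁n], ?_, ?_⟩
          · simp only [Function.comp_apply]
            rw [Equiv.swap_apply_of_ne_of_ne hxy hwx.symm, hσ₁x]
          · simp only [Function.comp_apply, Equiv.swap_apply_left, hw1]
        · have hy1 : σ₁ y = 1 := by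
            rcases Fin.exists_fin_two.mp ⟨σ₁ y, rfl⟩ with h | h
            · exact absurd h hy
            · exact h
          exact ⟨σ₁, hσ₁n, hσ₁x, hy1⟩
      have := hfdiff x y σ₂ hσ₂n hσ₂x hσ₂y
      rw [hb0, hb0, sub_self] at this
      linarith
    -- but `f 0 = 1` and `f e₀ = cos(2π/L) < 1`
    have hf0 : f 0 = 1 := by simp [hf]
    have hfe : f (Pi.single 0 1) = Real.cos (2 * Real.pi / L) := by
      simp only [hf, hk]
      rw [torusChar_single_re hL2 _ 0]
      simp only [latticeMomentum, Pi.single_eq_same, ZMod.val_one]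
      push_cast
      ring_nf
    have hlt : Real.cos (2 * Real.pi / L) < 1 := by
      have hLpos : (0 : ℝ) < L := by exact_mod_cast (by omega : 0 < L)
      have hL3 : (3 : ℝ) ≤ L := by exact_mod_cast hL
      have hxpos : 0 < 2 * Real.pi / L := by positivity
      have hxle : 2 * Real.pi / L ≤ Real.pi := by
        rw [div_le_iff₀ hLpos]; nlinarith [Real.pi_pos]
      rw [← Real.cos_zero]
      exact Real.cos_lt_cos_of_nonneg_of_le_pi le_rfl hxle hxpos
    have hne : (0 : TorusSite 2 L) ≠ Pi.single 0 1 := (torus_single_ne_zero hL2 0).symm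
    have := hfconst 0 (Pi.single 0 1) hne
    rw [hf0, hfe] at this
    linarith
  have hbpos : 0 < ∑ σ, b σ ^ 2 := lt_of_le_of_ne (Finset.sum_nonneg fun σ _ => sq_nonneg _) (Ne.symm hbne)
  -- (3) the normalised test amplitude and the Temple inequality
  set r : ℝ := Real.sqrt (∑ σ, b σ ^ 2) with hr
  have hrpos : 0 < r := Real.sqrt_pos.mpr hbpos
  have hr2 : r ^ 2 = ∑ σ, b σ ^ 2 := Real.sq_sqrt hbpos.le
  set φ : TensorIndex (TorusSite 2 L) 2 → ℝ := r⁻¹ • b with hφ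
  have hφσ : ∀ σ, φ σ = r⁻¹ * b σ := fun σ => by simp only [hφ, Pi.smul_apply, smul_eq_mul]
  have hφsupp : ∀ σ, φ σ ≠ 0 → zerosCard σ = n := by
    intro σ h
    apply hbsupp σ
    intro hb0
    exact h (by rw [hφσ, hb0, mul_zero])
  have hφmem : cplx L φ ∈ spinZSector (Λ := TorusSite 2 L) 1 M := mem_spinZSector_of_support M φ hφsupp
  have hφunit : ∑ σ, φ σ ^ 2 = 1 := by
    simp only [hφσ, mul_pow]
    rw [← Finset.mul_sum, ← hr2, inv_pow, inv_mul_cancel₀ (pow_ne_zero 2 hrpos.ne')]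
  have hφa : ∑ σ, a σ * φ σ = 0 := by
    simp only [hφσ]
    have : ∀ σ, a σ * (r⁻¹ * b σ) = r⁻¹ * (a σ * b σ) := fun σ => by ring
    simp_rw [this]
    rw [← Finset.mul_sum, hab0, mul_zero]
  have hφA : ∑ σ, φ σ * fmOp (torusGraph 2 L) φ σ = lam := by
    have hlin : ∀ σ, fmOp (torusGraph 2 L) φ σ = r⁻¹ * fmOp (torusGraph 2 L) b σ := by
      intro σ
      simp only [hφ, fmOp_smul', Pi.smul_apply, smul_eq_mul]
    calc ∑ σ, φ σ * fmOp (torusGraph 2 L) φ σ = ∑ σ, lam * φ σ ^ 2 := by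
          refine Finset.sum_congr rfl fun σ _ => ?_
          rw [hlin, hbA, hφσ]
          ring
      _ = lam := by rw [← Finset.mul_sum, hφunit, mul_one]
  have henergy : energyQ L 1 φ - sectorE L 1 M = lam := by
    rw [energyQ_eq_real]
    unfold sectorE ham
    have hq : ∑ σ, φ σ * (fmOp (torusGraph 2 L) φ σ + (1 - 1) * (isingW (torusGraph 2 L) σ * φ σ))
        = ∑ σ, φ σ * fmOp (torusGraph 2 L) φ σ :=
      Finset.sum_congr rfl fun σ _ => by ring
    rw [hq, hφA, hφunit]
    linarith [hE]
  have key := hg a φ ha hφmem hφunit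
  rw [hφa, henergy] at key
  simpa using key

end Summit.HubbardSuperconductivity.HubbardSuperconductivity.Theorems.AnisotropyChord.Transfer

end
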